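import Mathlib
import HarnessLib
import Summits.PneNP.PneNP.Theses.CnfIdealGenLength
import Summits.PneNP.PneNP.Theorems.CnfIdealGenLengthRankStability
import Literature.Computability.MetaComplexity.NCIPSFormulaCertificate
import Summits.PneNP.PneNP.Theorems.CnfIdealGenLengthRankDefectRepresentationsIffTautologyInstability
import Summits.PneNP.PneNP.Theorems.CnfIdealGenLengthRankDefectRepresentationsUniformStability
import Summits.PneNP.PneNP.Theorems.CnfIdealGenLengthRankDefectRepresentationsExactification
import Summits.PneNP.PneNP.Theorems.CnfIdealGenLengthRankDefectRepresentationsCutLemma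
import Summits.PneNP.PneNP.Theorems.CnfIdealGenLengthRankDefectRepresentationsSimReduction
import Summits.PneNP.PneNP.Theorems.CnfIdealGenLengthRankDefectRepresentationsOneSidedSim
import Summits.PneNP.PneNP.Theorems.CnfIdealGenLengthRankDefectRepresentationsSigmaSimThree
import Summits.PneNP.PneNP.Theorems.CnfIdealGenLengthRankDefectRepresentationsTwoStepLink
import Summits.PneNP.PneNP.Theorems.CnfIdealGenLengthRankDefectRepresentationsDefectShallow
import Summits.PneNP.PneNP.Theorems.CnfIdealGenLengthRankDefectRepresentationsTableOfGenerator
import Summits.PneNP.PneNP.Theorems.CnfIdealGenLengthRankDefectRepresentationsPolyOfAbsoluteMerge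
import Summits.PneNP.PneNP.Theorems.CnfIdealGenLengthRankDefectRepresentationsJointCutLemma
import Summits.PneNP.PneNP.Theorems.CnfIdealGenLengthRankDefectRepresentationsAbsoluteMergePair
import Summits.PneNP.PneNP.Theorems.CnfIdealGenLengthRankDefectRepresentationsFamilyCutLemma
import Summits.PneNP.PneNP.Theorems.CnfIdealGenLengthRankDefectRepresentationsGoodBlocks

/-!
# Line `cell-union-merge` for the crux `RankDefectRepresentations` (stmt-PneNP-18923, route `CnfIdealGenLength`)

Strategist line (planner `cstrat-stmt-PneNP-18923`, 2026-08-29); ADOPTED AS THE LIVE LEAD LINE by lead g17 at 14:45Z (PICKED addendum g17-2: the Σ-SIM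
lane of `rank_dehn_ladder.lean` is folded in — its open stub `stub_sigmaSim` and its in-flight bench stubs `stub_twoStepLink`/`stub_defectShallow` are
carried here verbatim, W21/W22 are closed by name).  Originally registered ALONGSIDE the lead line `rank-dehn-ladder`
(`Lines/rank_dehn_ladder.lean`, RESHAPE 17 of lead g17; memo `Lines/cell_union_merge.md`).  It CARRIES ALL SIX registered stubs of that
skeleton VERBATIM (`stub_superpolyInstability`, `stub_tautologyInstability`, `stub_uniformStability`, `stub_sigmaSim`, `stub_oneSidedSim`,
`stub_sigmaSimThree` — same names and signatures, so registering this file de-registers nothing of the live lead's bench) and adds ONE new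
lead-sized target ABOVE DEPTH 2 (`stub_absoluteMerge`) plus three TRUE worker stubs, with the kernel-checked composition

  `stub_absoluteMerge → stub_jointCutLemma → stub_polyOfAbsoluteMerge → stub_tableOfGenerator → stub_uniformStability` (N0b, BY NAME)
  `→ ¬ RankDefectRepresentations` (`uniformStability_of_stubs`, `not_RankDefectRepresentations_of_absoluteMerge`).

## RESHAPE g18 (lead g18, 2026-08-29): AMB = FAMILY CUT LEMMA (landed) + BLOCK EXACTIFICATION (the one open stub)

Lead g17 split `stub_absoluteMerge` into a family cut lemma (reduced there to rank-metric Kalton–Roberts,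
`stub_rankKaltonRoberts`) and an exactification step.  The family cut lemma is now a THEOREM, in frame form and with no
Kalton–Roberts input (`…Theorems.CnfIdealGenLengthRankDefectRepresentationsFamilyCutLemma.familyCutLemma`, p734569:
`c(P,Q) ≤ c ⇒ ∃ r ≤ 32c, U, W: Q_y = G_y + U α_y + β_y W` with `G_y ∈ Comm(P)`; proof = the derivative trick over `K(s)`,
memo `Lines/cell-union-merge-g18.md` §3), so `stub_rankKaltonRoberts` is DE-REGISTERED (moot; never used by a composition)
and `stub_absoluteMerge` is no longer a sorry: it is DERIVED (`stub_absoluteMerge`, `absoluteMerge_of_blockExactification`)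
from the family cut lemma and ONE new registered lead stub, `stub_blockExactification` (BE): given the frame decomposition,
produce the commuting exact pair at union-uniform cost `μ·r`.  BE ⟺ AMB given the family cut lemma (memo §4); what it
isolates is the pure EXACTIFICATION content of the merge (spread frames; memo §4–§5).  Also landed g18 (tools, all
`--supports` this item): `…Insertion` (absolute-constant insertion step, p732888), `…TwoGenerators` (AMB for `|X| = 4`,
p733525), `…CommutantCutLemma` (cut lemma in commutant form; generic unions are cheap, p734130).

RESHAPE 18b (same session): `stub_blockExactification` is in turn DERIVED (`blockExactification_of_core`) from
`…Theorems.…GoodBlocks.goodBlocks` (p736001: all but ≤ 8r blocks carry an EXACTLY exact compressed family) +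
`card_filter_mul_ne_zero_le_rank` (≤ 2r further blocks where the compressed cells fail to sum to the block) and the ONE open
lead stub `stub_coreExactification` (CoreBE) = BE with the ≤ 10r exceptional blocks handed over explicitly; memo §7 reduces it
further (pencil) to the DOUBLE CORE |X|, |Y| = O(r).  Also landed: `…RankOneCells` (AMB when every P-cell has rank one, p736423).

## The new currency: ALL-UNIONS cross data, and why it does not inflate under merging

Every divide-and-conquer attempt on N0b in the lane (g7 §3, g8 §8, g9–g16 SIM halving) measured the interaction of two solved
halves in the COORDINATE / generator currency and lost a factor `|I|·|J|` (resp. `|κ||κ′|`) per level — tight there (cut domination is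
optimal for general matrices), hence `n^{Θ(log n)}`.  Here the interaction of two EXACT cell systems `P : X → K^{d×d}`, `Q : Y → K^{d×d}`
(complete orthogonal idempotents; think of the `2^m` joint eigenspaces of a solved block of `m` generators) is measured by
  `c(P,Q) := max_{A ⊆ X, B ⊆ Y} rank [P_A, Q_B]`,   `P_A := Σ_{x∈A} P_x`  (ALL cell unions, a MAX not a sum).
Two facts make this currency close under dyadic merging with ABSOLUTE loss:
* `stub_jointCutLemma` (JCL, TRUE): if `P, Q` COMMUTE and `G` is any matrix with `rank[P_A, G] ≤ u` (all `A`) and `rank[Q_B, G] ≤ v`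
  (all `B`), then EVERY union of JOINT cells `R_C = Σ_{(x,y)∈C} P_x Q_y`, `C ⊆ X × Y` arbitrary, has `rank[R_C, G] ≤ κ(u+v)`, `κ` absolute
  (proof: `rank[Π,G]` is the cut of `G` along `Π`; the cut lemma `exists_blockDiagonal_of_maxCut` (p642852) puts `G` within `4u` of the
  commutant of `P`; for `P`-block-diagonal `G₁` the joint cut is the sum over `P`-cells of `Q`-cuts of the diagonal blocks, and
  `maxcut ≤ 4·(average cut)` by the coset-of-`{∅,B*,B*ᶜ,Y}` tiling argument, while averages of cylinder cuts add up to `≤ v`; §3.T2 of the memo).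
  Contrast: with only the `a+b` COORDINATE cuts as hypothesis the best bound is their SUM (cut domination) — the old currency.
* `stub_absoluteMerge` (AMB, the LEAD target, = g7-final §3 "MERGE*" typed): two exact systems with `c(P,Q) ≤ c` are, union by union,
  within rank `λ·c` of a COMMUTING pair of exact systems, `λ` ABSOLUTE.  Shadow that is a theorem: `|X| = 2` (ONE idempotent against an
  exact Boolean algebra of ANY size: cut lemma with `|Y|` colours + blockwise exactification, `λ ≤ 16`, `Q' = Q`) — g7-final §3 "MERGE* for
  m = 1"; of the same flavour, the double max-cut decomposition with constant 4 of g16 (p715699).  `λ` polynomial in `min(|X|,|Y|)` is easy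
  (insert the `log|X|` generators one at a time, JCL at each insertion) and USELESS (`|X| = 2^(2^k)` cells at level `k`); `λ` absolute is the bet.
Bookkeeping (`stub_polyOfAbsoluteMerge`, TRUE): pad `n` to `2^L`; level `k` = blocks of `2^k` generators, each with an exact cell system
`P^S`, invariants `rank(E_l − gen P^S_l) ≤ C_k t` and `c(P^S, P^T) ≤ U_k t` (`U_0 = 1`: the unions of `{E,1−E}` are `0,E,1−E,1`); merge pairs
by AMB (`c = U_k t`), take the product system; JCL twice gives `U_{k+1} ≤ 2κ(2κ(1+2λ)+2λ)·U_k =: θ U_k`, and `C_{k+1} = C_k + λU_k`; so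
`C_L ≤ λLθ^L = poly(n)`: generator-form N0b (`PolyStableIdem`), then the table form (`stub_tableOfGenerator`), then `¬RDR` (p607059, p542939).

## Registered stubs of THIS file (its only sorries)
carried verbatim from RESHAPE 17 (the live lead's, untouched): `stub_superpolyInstability` (rung 2), `stub_tautologyInstability` (≡ crux;
`RankDefectRepresentations_holds_of_stubs`), `stub_uniformStability` (N0b), `stub_sigmaSim` (lead g17's Σ-SIM, depth 2), `stub_oneSidedSim`,
`stub_sigmaSimThree` (g17 bench W21/W22).  NEW, TRUE, cut for one-generation stub-workers: `stub_tableOfGenerator` (M), `stub_jointCutLemma`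
(M/L), `stub_polyOfAbsoluteMerge` (L, pure bookkeeping).  NEW LEAD-SIZED (open, above depth 2): `stub_absoluteMerge`.
RELATION TO THE Σ-SIM LANE: Σ-SIM is the depth-2 (linearised, one-level) gluing problem in a summed coordinate currency; this line is the
ALL-LEVELS recursion in the union currency — the two are independent bets and compose (a polynomial SIM does not by itself climb levels;
AMB is the exact-systems merge that does, given JCL).
HONEST FRAMING: nothing here bears on P ≠ NP; closing N0b REFUTES the crux (the F-N2 frontier rung dies); a refutation of AMB kills every
divide-and-conquer route to N0b and is the first above-depth-2 obstruction on record.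
-/

namespace Summit.PneNP.PneNP.Cruxes.RankDefectRepresentations.CellUnionMerge

open Filter
open Literature.Computability.Complexity
open Literature.Computability.MetaComplexity
open Literature.Computability.MetaComplexity.NCIPS
open Summit.PneNP.PneNP.Theorems.CnfIdealGenLength

/-! ## Statements (named `def`s; every registered stub below restates one of them UNFOLDED) -/

section Defs

/-- N0b, TABLE form (= the registered `stub_uniformStability` of `rank_dehn_ladder.lean`, verbatim). -/
def UniformStability : Prop :=
  ∃ a : ℕ, ∀ᶠ n : ℕ in atTop, ∀ (K : Type) [Field K] [CharZero K] (d δ : ℕ)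
    (ρ : Finset (Fin n) → Matrix (Fin d) (Fin d) K), ρ ∅ = 1 →
    (∀ S T : Finset (Fin n), (ρ S * ρ T - ρ (symmDiff S T)).rank ≤ δ) →
    ∃ π : Finset (Fin n) → Matrix (Fin d) (Fin d) K, π ∅ = 1 ∧
      (∀ S T : Finset (Fin n), π S * π T = π (symmDiff S T)) ∧
      ∀ S : Finset (Fin n), (ρ S - π S).rank ≤ n ^ a * δ

/-- N0b, GENERATOR form on exact idempotents ("POLYSTAB", g7-final §3): `n` idempotents with pairwise commutator ranks `≤ t` are
(eventually in `n`; uniformly in the characteristic-0 field, the dimension and `t`) within rank `n^a·t` of commuting idempotents. -/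
def PolyStableIdem : Prop :=
  ∃ a : ℕ, ∀ᶠ n : ℕ in atTop, ∀ (K : Type) [Field K] [CharZero K] (d t : ℕ)
    (E : Fin n → Matrix (Fin d) (Fin d) K), (∀ i, E i * E i = E i) →
    (∀ i j, (E i * E j - E j * E i).rank ≤ t) →
    ∃ E' : Fin n → Matrix (Fin d) (Fin d) K, (∀ i, E' i * E' i = E' i) ∧ (∀ i j, E' i * E' j = E' j * E' i) ∧
      ∀ i, (E i - E' i).rank ≤ n ^ a * t

/-- **AMB(λ) — absolute merge in the cell-union currency** (the LEAD target; g7-final §3 MERGE*, typed).  Two complete orthogonal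
systems of idempotents, indexed by arbitrary finite types, whose cell unions almost commute (`rank[P_A, Q_B] ≤ c` for ALL `A ⊆ X`,
`B ⊆ Y`) are within `λ·c` — union by union — of a COMMUTING pair of complete orthogonal systems. -/
def AbsoluteMerge (lam : ℕ) : Prop :=
  ∀ (K : Type) [Field K] [CharZero K] (d : ℕ) (X Y : Type) [Fintype X] [Fintype Y]
    (P : X → Matrix (Fin d) (Fin d) K) (Q : Y → Matrix (Fin d) (Fin d) K) (c : ℕ),
    (∀ x, P x * P x = P x) → (∀ x x', x ≠ x' → P x * P x' = 0) → ∑ x, P x = 1 →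
    (∀ y, Q y * Q y = Q y) → (∀ y y', y ≠ y' → Q y * Q y' = 0) → ∑ y, Q y = 1 →
    (∀ (A : Finset X) (B : Finset Y),
      ((∑ x ∈ A, P x) * (∑ y ∈ B, Q y) - (∑ y ∈ B, Q y) * (∑ x ∈ A, P x)).rank ≤ c) →
    ∃ (P' : X → Matrix (Fin d) (Fin d) K) (Q' : Y → Matrix (Fin d) (Fin d) K),
      (∀ x, P' x * P' x = P' x) ∧ (∀ x x', x ≠ x' → P' x * P' x' = 0) ∧ ∑ x, P' x = 1 ∧
      (∀ y, Q' y * Q' y = Q' y) ∧ (∀ y y', y ≠ y' → Q' y * Q' y' = 0) ∧ ∑ y, Q' y = 1 ∧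
      (∀ x y, P' x * Q' y = Q' y * P' x) ∧
      (∀ A : Finset X, ((∑ x ∈ A, P x) - ∑ x ∈ A, P' x).rank ≤ lam * c) ∧
      (∀ B : Finset Y, ((∑ y ∈ B, Q y) - ∑ y ∈ B, Q' y).rank ≤ lam * c)

/-- **JCL(κ) — the joint cut lemma** (TRUE for a suitable absolute `κ`; `κ = 40` by the proof in the memo §3.T2).  For a COMMUTING
pair of complete orthogonal systems `P, Q` and any matrix `G`: if every `P`-union and every `Q`-union almost commutes with `G`
(ranks `≤ u`, `≤ v`), then every union of JOINT cells `Σ_{(x,y)∈C} P_x Q_y`, `C ⊆ X × Y` ARBITRARY, commutes with `G` up to rank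
`κ(u+v)`.  (Any field.) -/
def JointCutLemma (κ : ℕ) : Prop :=
  ∀ (K : Type) [Field K] (d : ℕ) (X Y : Type) [Fintype X] [Fintype Y]
    (P : X → Matrix (Fin d) (Fin d) K) (Q : Y → Matrix (Fin d) (Fin d) K) (G : Matrix (Fin d) (Fin d) K) (u v : ℕ),
    (∀ x, P x * P x = P x) → (∀ x x', x ≠ x' → P x * P x' = 0) → ∑ x, P x = 1 →
    (∀ y, Q y * Q y = Q y) → (∀ y y', y ≠ y' → Q y * Q y' = 0) → ∑ y, Q y = 1 →
    (∀ x y, P x * Q y = Q y * P x) →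
    (∀ A : Finset X, ((∑ x ∈ A, P x) * G - G * ∑ x ∈ A, P x).rank ≤ u) →
    (∀ B : Finset Y, ((∑ y ∈ B, Q y) * G - G * ∑ y ∈ B, Q y).rank ≤ v) →
    ∀ C : Finset (X × Y),
      ((∑ p ∈ C, P p.1 * Q p.2) * G - G * ∑ p ∈ C, P p.1 * Q p.2).rank ≤ κ * (u + v)

/-- **The polynomial bookkeeping** (TRUE; dyadic two-invariant recursion, memo §3.T3): AMB + JCL ⇒ generator-form N0b. -/
def PolyOfAbsoluteMerge : Prop :=
  ∀ lam κ : ℕ, AbsoluteMerge lam → JointCutLemma κ → PolyStableIdem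

end Defs

/-! ## Registered stubs (the ONLY sorries of this file; each stated UNFOLDED so a `Theorems/` file can restate it verbatim) -/

/-- CARRIED VERBATIM from `rank_dehn_ladder.lean` (rung 2, open). -/
theorem stub_superpolyInstability :
    ∀ c : ℕ, ∀ᶠ n : ℕ in atTop, ∃ (K : Type) (_ : Field K) (_ : CharZero K) (d t : ℕ)
      (M : Fin n → Matrix (Fin d) (Fin d) K),
      (∀ g : MonoidAlgebra K (FreeMonoid (Fin n)), IsAxiom g →
        (MonoidAlgebra.lift K (Matrix (Fin d) (Fin d) K) (FreeMonoid (Fin n)) (FreeMonoid.lift M) g).rank ≤ t) ∧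
      ∀ M' : Fin n → Matrix (Fin d) (Fin d) K, ((∀ i, M' i * M' i = M' i) ∧ ∀ i j, M' i * M' j = M' j * M' i) →
        ∃ i, n ^ c * t < (M i - M' i).rank := by
  sorry

/-- CARRIED VERBATIM from `rank_dehn_ladder.lean` (rung 3♭ ≡ the crux, open; positive side, Frege-barred). -/
theorem stub_tautologyInstability :
    ∃ s : Polynomial ℕ, ∀ c : ℕ, ∀ᶠ n : ℕ in atTop, ∃ (K : Type) (_ : Field K) (_ : CharZero K) (d t : ℕ)
      (M : Fin n → Matrix (Fin d) (Fin d) K) (T : PropForm (Fin n)),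
      (∀ g : MonoidAlgebra K (FreeMonoid (Fin n)), IsAxiom g →
        (MonoidAlgebra.lift K (Matrix (Fin d) (Fin d) K) (FreeMonoid (Fin n)) (FreeMonoid.lift M) g).rank ≤ t) ∧
      T.IsTautology ∧ T.size ≤ s.eval n ∧
      n ^ c * t < (MonoidAlgebra.lift K (Matrix (Fin d) (Fin d) K) (FreeMonoid (Fin n)) (FreeMonoid.lift M) (tr K T)).rank := by
  sorry

/-- CARRIED VERBATIM from `rank_dehn_ladder.lean` (N0b, open; its proof REFUTES the crux).  This file DERIVES this statement from
its own stubs: `uniformStability_of_stubs`. -/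
theorem stub_uniformStability :
    ∃ a : ℕ, ∀ᶠ n : ℕ in atTop, ∀ (K : Type) [Field K] [CharZero K] (d δ : ℕ)
      (ρ : Finset (Fin n) → Matrix (Fin d) (Fin d) K), ρ ∅ = 1 →
      (∀ S T : Finset (Fin n), (ρ S * ρ T - ρ (symmDiff S T)).rank ≤ δ) →
      ∃ π : Finset (Fin n) → Matrix (Fin d) (Fin d) K, π ∅ = 1 ∧
        (∀ S T : Finset (Fin n), π S * π T = π (symmDiff S T)) ∧
        ∀ S : Finset (Fin n), (ρ S - π S).rank ≤ n ^ a * δ := by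
  sorry

/-- CARRIED VERBATIM from `rank_dehn_ladder.lean` RESHAPE 17 (lead g17's OPEN stub: Σ-SIM with a polynomial constant). -/
theorem stub_sigmaSim :
    ∃ c : ℕ, ∀ (K : Type) [Field K] (n : ℕ) (ι ι' : Type) [Fintype ι] [Fintype ι'] [DecidableEq ι] [DecidableEq ι'] (row : ι → Fin n → Bool) (col : ι' → Fin n → Bool) (y : Fin n → Matrix ι ι' K), (∀ k, Summit.PneNP.PneNP.Theorems.CnfIdealGenLengthRankDefectRepresentationsSimReduction.cut row col k (y k) = y k) → ∃ z : Matrix ι ι' K, ∑ k, (Summit.PneNP.PneNP.Theorems.CnfIdealGenLengthRankDefectRepresentationsSimReduction.cut row col k (z - y k)).rank ≤ (n + 1) ^ c * ∑ k, ∑ l, (Summit.PneNP.PneNP.Theorems.CnfIdealGenLengthRankDefectRepresentationsSimReduction.cut row col k (Summit.PneNP.PneNP.Theorems.CnfIdealGenLengthRankDefectRepresentationsSimReduction.cut row col l (y k - y l))).rank := by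
  sorry

/-- CARRIED from `rank_dehn_ladder.lean` RESHAPE 17 (g17 bench §W21: one-sided SIM) — CLOSED by name, p723862. -/
theorem stub_oneSidedSim :
    ∀ (K : Type) [Field K] (n : ℕ) (ι ι' : Type) [Fintype ι] [Fintype ι'] [DecidableEq ι] [DecidableEq ι'] (r : Fin n → Bool) (col : ι' → Fin n → Bool) (y : Fin n → Matrix ι ι' K), (∀ k, Summit.PneNP.PneNP.Theorems.CnfIdealGenLengthRankDefectRepresentationsSimReduction.cut (fun _ => r) col k (y k) = y k) → ∃ z : Matrix ι ι' K, ∀ k, (Summit.PneNP.PneNP.Theorems.CnfIdealGenLengthRankDefectRepresentationsSimReduction.cut (fun _ => r) col k (z - y k)).rank ≤ ∑ l, (Summit.PneNP.PneNP.Theorems.CnfIdealGenLengthRankDefectRepresentationsSimReduction.cut (fun _ => r) col k (Summit.PneNP.PneNP.Theorems.CnfIdealGenLengthRankDefectRepresentationsSimReduction.cut (fun _ => r) col l (y k - y l))).rank :=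
  Summit.PneNP.PneNP.Theorems.CnfIdealGenLengthRankDefectRepresentationsOneSidedSim.stub_oneSidedSim

/-- CARRIED from `rank_dehn_ladder.lean` RESHAPE 17 (g17 bench §W22: Σ-SIM for three coordinates) — CLOSED by name, p723784. -/
theorem stub_sigmaSimThree :
    ∀ (K : Type) [Field K] (ι ι' : Type) [Fintype ι] [Fintype ι'] [DecidableEq ι] [DecidableEq ι'] (row : ι → Fin 3 → Bool) (col : ι' → Fin 3 → Bool) (y : Fin 3 → Matrix ι ι' K), (∀ k, Summit.PneNP.PneNP.Theorems.CnfIdealGenLengthRankDefectRepresentationsSimReduction.cut row col k (y k) = y k) → ∃ z : Matrix ι ι' K, ∑ k, (Summit.PneNP.PneNP.Theorems.CnfIdealGenLengthRankDefectRepresentationsSimReduction.cut row col k (z - y k)).rank ≤ 3 * (Summit.PneNP.PneNP.Theorems.CnfIdealGenLengthRankDefectRepresentationsSimReduction.cut row col 0 (Summit.PneNP.PneNP.Theorems.CnfIdealGenLengthRankDefectRepresentationsSimReduction.cut row col 1 (y 0 - y 1))).rank + 3 * (Summit.PneNP.PneNP.Theorems.CnfIdealGenLengthRankDefectRepresentationsSimReduction.cut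 row col 0 (Summit.PneNP.PneNP.Theorems.CnfIdealGenLengthRankDefectRepresentationsSimReduction.cut row col 2 (y 0 - y 2))).rank + (Summit.PneNP.PneNP.Theorems.CnfIdealGenLengthRankDefectRepresentationsSimReduction.cut row col 1 (Summit.PneNP.PneNP.Theorems.CnfIdealGenLengthRankDefectRepresentationsSimReduction.cut row col 2 (y 1 - y 2))).rank :=
  Summit.PneNP.PneNP.Theorems.CnfIdealGenLengthRankDefectRepresentationsSigmaSimThree.stub_sigmaSimThree


/-- CARRIED VERBATIM from `rank_dehn_ladder.lean` RESHAPE 17c (lead g17; bench §W24, CLOSED by name p726175: the two-step link — a SIM glue is a genuine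
representation near a two-step almost-representation). -/
theorem stub_twoStepLink :
    ∀ (K : Type) [Field K] (n : ℕ) (ιA ιB : Type) [Fintype ιA] [Fintype ιB] [DecidableEq ιA] [DecidableEq ιB]
      (α : ιA → Fin n → Bool) (β : ιB → Fin n → Bool) (X : Fin n → Matrix ιA ιB K) (Z : Matrix ιA ιB K),
      (∀ i a b, α a i = β b i → X i a b = 0) →
      ∃ E' : Fin n → Matrix (ιA ⊕ ιB) (ιA ⊕ ιB) K,
        (∀ i, E' i * E' i = E' i) ∧ (∀ i j, E' i * E' j = E' j * E' i) ∧
        ∀ i, (Matrix.fromBlocks (Matrix.diagonal fun a => if α a i then (1 : K) else 0) (X i) 0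
                (Matrix.diagonal fun b => if β b i then (1 : K) else 0) - E' i).rank ≤
          (Matrix.of fun a b => if α a i ≠ β b i then X i a b - (if α a i then Z a b else -Z a b) else 0).rank :=
  Summit.PneNP.PneNP.Theorems.CnfIdealGenLengthRankDefectRepresentationsTwoStepLink.stub_twoStepLink

/-- CARRIED VERBATIM from `rank_dehn_ladder.lean` RESHAPE 17c (lead g17; bench §W25, CLOSED by name p726204: pairwise defects are shallow up to rank `64(n+1)t`). -/
theorem stub_defectShallow :
    ∀ (K : Type) [Field K] (n : ℕ) (ι ι' : Type) [Fintype ι] [Fintype ι'] [DecidableEq ι] [DecidableEq ι']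
      (row : ι → Fin n → Bool) (col : ι' → Fin n → Bool) (y : Fin n → Matrix ι ι' K) (t : ℕ) (k l : Fin n),
      (∀ i j, (Summit.PneNP.PneNP.Theorems.CnfIdealGenLengthRankDefectRepresentationsSimReduction.cut row col i (Summit.PneNP.PneNP.Theorems.CnfIdealGenLengthRankDefectRepresentationsSimReduction.cut row col j (y i - y j))).rank ≤ t) →
      ∃ S : Matrix ι ι' K,
        (∀ x x', (row x k = col x' k ∨ row x l = col x' l ∨ ∃ j, j ≠ k ∧ j ≠ l ∧ row x j ≠ col x' j) → S x x' = 0) ∧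
        (Summit.PneNP.PneNP.Theorems.CnfIdealGenLengthRankDefectRepresentationsSimReduction.cut row col k (Summit.PneNP.PneNP.Theorems.CnfIdealGenLengthRankDefectRepresentationsSimReduction.cut row col l (y k - y l)) - S).rank ≤ 64 * (n + 1) * t :=
  Summit.PneNP.PneNP.Theorems.CnfIdealGenLengthRankDefectRepresentationsDefectShallow.stub_defectShallow

/-- **T1 `stub_tableOfGenerator`** — CLOSED by bench B2, p727207 `Theorems/…TableOfGenerator` (267 l.).  Generator-form poly-stability of idempotents ⇒ the table form N0b.
Proof (memo §3.T1): from the table `ρ` put `U_i := ρ {i}`, `M_i := (1 − U_i)/2` (`M_i² − M_i = (ρ{i}ρ{i} − ρ∅)/4`, rank `≤ δ`;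
`rank[M_i,M_j] ≤ 2δ`), exactify (`exists_idempotent_near`: idempotents `E_i`, `rank(E_i − M_i) ≤ δ`, commutators `≤ 6δ`), apply the
hypothesis with `t = 6δ`, put `U'_i := 1 − 2E'_i` (commuting involutions) and `π S :=` the sorted product of the `U'_i`, `i ∈ S`;
`π ∅ = 1` (`sortedProd_empty`), `π S π T = π (S △ T)` (`stub_sortingLemma` at `t = 0`), and
`rank(ρ S − π S) ≤ |S|·δ + Σ_{i∈S} rank(U_i − U'_i) ≤ nδ + n(6n^a + 1)δ ≤ n^{a+2} δ` for `n ≥ 8`. -/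
theorem stub_tableOfGenerator :
    (∃ a : ℕ, ∀ᶠ n : ℕ in atTop, ∀ (K : Type) [Field K] [CharZero K] (d t : ℕ)
      (E : Fin n → Matrix (Fin d) (Fin d) K), (∀ i, E i * E i = E i) →
      (∀ i j, (E i * E j - E j * E i).rank ≤ t) →
      ∃ E' : Fin n → Matrix (Fin d) (Fin d) K, (∀ i, E' i * E' i = E' i) ∧ (∀ i j, E' i * E' j = E' j * E' i) ∧
        ∀ i, (E i - E' i).rank ≤ n ^ a * t) →
    ∃ a : ℕ, ∀ᶠ n : ℕ in atTop, ∀ (K : Type) [Field K] [CharZero K] (d δ : ℕ)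
      (ρ : Finset (Fin n) → Matrix (Fin d) (Fin d) K), ρ ∅ = 1 →
      (∀ S T : Finset (Fin n), (ρ S * ρ T - ρ (symmDiff S T)).rank ≤ δ) →
      ∃ π : Finset (Fin n) → Matrix (Fin d) (Fin d) K, π ∅ = 1 ∧
        (∀ S T : Finset (Fin n), π S * π T = π (symmDiff S T)) ∧
        ∀ S : Finset (Fin n), (ρ S - π S).rank ≤ n ^ a * δ :=
  Summit.PneNP.PneNP.Theorems.CnfIdealGenLengthRankDefectRepresentationsTableOfGenerator.stub_tableOfGenerator

/-- **T2 `stub_jointCutLemma`** — CLOSED by bench B1, p728169 (+ helper p727890) `Theorems/…JointCutLemma`, κ = 144 (sharper unpacked `jointCut`: 144u + 8v).  Proof (memo §3.T2): (0) for an idempotent `Π`,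
`rank[Π,G] = rank(ΠG(1−Π)) + rank((1−Π)GΠ)` (images in complementary subspaces) — "commutator with a union = cut";
(1) in a basis adapted to `⊕_x im P_x` (`DirectSum.IsInternal.collectedBasis`) the hypothesis says every bipartition cut of `G` for the
colouring `x` is `≤ u`, so `exists_blockDiagonal_of_maxCut` (p642852) gives `G₁` with `P_x G₁ P_{x'} = 0 (x ≠ x')` and
`rank(G − G₁) ≤ 4u`; (2) for such `G₁` and any `C ⊆ X × Y`: `R_C G₁ (1−R_C) = Σ_x P_x (Q_{C_x} G₁ Q_{C_xᶜ}) P_x` (fibres `C_x`), a sum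
with ranks adding over `x`, so `rank[R_C, G₁] ≤ Σ_x maxcut_Q(P_x G₁ P_x)`; (3) AVERAGING: for any `M` and any `B*`,
`Σ_{B ⊆ Y} cut_B(M) ≥ 2^{|Y|}·cut_{B*}(M)/4` (tile `M_{B*×B*ᶜ}` by the four pieces read off the coset `{B, B△B*, B△B*ᶜ, Bᶜ}`), hence
`Σ_x maxcut_Q(P_xG₁P_x) ≤ 4·avg_B Σ_x cut_B(P_xG₁P_x) = 4·avg_B rank[Q_B, G₁] ≤ 4(v + 8u)`; (4) `rank[R_C,G] ≤ rank[R_C,G₁] + 8u`. -/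
theorem stub_jointCutLemma :
    ∃ κ : ℕ,
    ∀ (K : Type) [Field K] (d : ℕ) (X Y : Type) [Fintype X] [Fintype Y]
      (P : X → Matrix (Fin d) (Fin d) K) (Q : Y → Matrix (Fin d) (Fin d) K) (G : Matrix (Fin d) (Fin d) K) (u v : ℕ),
      (∀ x, P x * P x = P x) → (∀ x x', x ≠ x' → P x * P x' = 0) → ∑ x, P x = 1 →
      (∀ y, Q y * Q y = Q y) → (∀ y y', y ≠ y' → Q y * Q y' = 0) → ∑ y, Q y = 1 →
      (∀ x y, P x * Q y = Q y * P x) →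
      (∀ A : Finset X, ((∑ x ∈ A, P x) * G - G * ∑ x ∈ A, P x).rank ≤ u) →
      (∀ B : Finset Y, ((∑ y ∈ B, Q y) * G - G * ∑ y ∈ B, Q y).rank ≤ v) →
      ∀ C : Finset (X × Y),
        ((∑ p ∈ C, P p.1 * Q p.2) * G - G * ∑ p ∈ C, P p.1 * Q p.2).rank ≤ κ * (u + v) :=
  Summit.PneNP.PneNP.Theorems.CnfIdealGenLengthRankDefectRepresentationsJointCutLemma.stub_jointCutLemma

/-- **T3 `stub_polyOfAbsoluteMerge`** — CLOSED by bench B3, p727747 `Theorems/…PolyOfAbsoluteMerge` (17 min) — (pure bookkeeping, the analogue one level up of `…SimBoundQuasiPoly` p719105).**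
Proof (memo §3.T3): pad with zero idempotents to `n = 2^L`; by induction on the level `k` build, for every dyadic block `S` of size `2^k`,
a complete orthogonal system `P^S` indexed by a finite type (e.g. `S → Bool`, or an iterated product) with
(cost) `rank(E_l − gen^S_l) ≤ C_k·t` where `gen^S_l` is the union of the cells of `P^S` lying under `E_l`, and
(cross) `rank[P^S_A, P^T_B] ≤ U_k·t` for distinct blocks `S ≠ T` and ALL unions `A, B`; `k = 0`: `P^{{l}} = {E_l, 1 − E_l}`, `C_0 = 0`,
`U_0 = 1`.  Step: merge the two halves by AMB (`c = U_k t`), product system `R_{(x,y)} = P'_x Q'_y` (complete orthogonal, its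
half-unions are the `P'`- and `Q'`-unions), `C_{k+1} = C_k + λU_k`; the new cross bound by JCL twice (observer = a joint union of the other
merged pair, then observer = an old union): `U_{k+1} = 2κ(2κ(1+2λ) + 2λ)·U_k`.  At the top, `E'_l := gen_l` are commuting idempotents and
`C_L ≤ λ·L·θ^L ≤ n^a` eventually. -/
theorem stub_polyOfAbsoluteMerge :
    ∀ lam κ : ℕ,
    (∀ (K : Type) [Field K] [CharZero K] (d : ℕ) (X Y : Type) [Fintype X] [Fintype Y]
      (P : X → Matrix (Fin d) (Fin d) K) (Q : Y → Matrix (Fin d) (Fin d) K) (c : ℕ),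
      (∀ x, P x * P x = P x) → (∀ x x', x ≠ x' → P x * P x' = 0) → ∑ x, P x = 1 →
      (∀ y, Q y * Q y = Q y) → (∀ y y', y ≠ y' → Q y * Q y' = 0) → ∑ y, Q y = 1 →
      (∀ (A : Finset X) (B : Finset Y),
        ((∑ x ∈ A, P x) * (∑ y ∈ B, Q y) - (∑ y ∈ B, Q y) * (∑ x ∈ A, P x)).rank ≤ c) →
      ∃ (P' : X → Matrix (Fin d) (Fin d) K) (Q' : Y → Matrix (Fin d) (Fin d) K),
        (∀ x, P' x * P' x = P' x) ∧ (∀ x x', x ≠ x' → P' x * P' x' = 0) ∧ ∑ x, P' x = 1 ∧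
        (∀ y, Q' y * Q' y = Q' y) ∧ (∀ y y', y ≠ y' → Q' y * Q' y' = 0) ∧ ∑ y, Q' y = 1 ∧
        (∀ x y, P' x * Q' y = Q' y * P' x) ∧
        (∀ A : Finset X, ((∑ x ∈ A, P x) - ∑ x ∈ A, P' x).rank ≤ lam * c) ∧
        (∀ B : Finset Y, ((∑ y ∈ B, Q y) - ∑ y ∈ B, Q' y).rank ≤ lam * c)) →
    (∀ (K : Type) [Field K] (d : ℕ) (X Y : Type) [Fintype X] [Fintype Y]
      (P : X → Matrix (Fin d) (Fin d) K) (Q : Y → Matrix (Fin d) (Fin d) K) (G : Matrix (Fin d) (Fin d) K) (u v : ℕ),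
      (∀ x, P x * P x = P x) → (∀ x x', x ≠ x' → P x * P x' = 0) → ∑ x, P x = 1 →
      (∀ y, Q y * Q y = Q y) → (∀ y y', y ≠ y' → Q y * Q y' = 0) → ∑ y, Q y = 1 →
      (∀ x y, P x * Q y = Q y * P x) →
      (∀ A : Finset X, ((∑ x ∈ A, P x) * G - G * ∑ x ∈ A, P x).rank ≤ u) →
      (∀ B : Finset Y, ((∑ y ∈ B, Q y) * G - G * ∑ y ∈ B, Q y).rank ≤ v) →
      ∀ C : Finset (X × Y),
        ((∑ p ∈ C, P p.1 * Q p.2) * G - G * ∑ p ∈ C, P p.1 * Q p.2).rank ≤ κ * (u + v)) →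
    ∃ a : ℕ, ∀ᶠ n : ℕ in atTop, ∀ (K : Type) [Field K] [CharZero K] (d t : ℕ)
      (E : Fin n → Matrix (Fin d) (Fin d) K), (∀ i, E i * E i = E i) →
      (∀ i j, (E i * E j - E j * E i).rank ≤ t) →
      ∃ E' : Fin n → Matrix (Fin d) (Fin d) K, (∀ i, E' i * E' i = E' i) ∧ (∀ i j, E' i * E' j = E' j * E' i) ∧
        ∀ i, (E i - E' i).rank ≤ n ^ a * t :=
  Summit.PneNP.PneNP.Theorems.CnfIdealGenLengthRankDefectRepresentationsPolyOfAbsoluteMerge.stub_polyOfAbsoluteMerge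

/-- Registered stub (lead g17) — CLOSED by bench W26, p727869 `Theorems/…AbsoluteMergePair` (329 l., constant 12c ≤ 16c): the |X| = 2 SHADOW of AMB:
**one idempotent against an exact system of any size.**  If `E` is an idempotent whose commutator with EVERY union `Q_B` of a complete orthogonal system
`Q` has rank `≤ c`, then `E` is within rank `16·c` of an idempotent commuting with every `Q_y` (so AMB holds for the two-cell system `{E, 1−E}` with
`λ = 16` and `Q' = Q`).  Proof: in a basis adapted to `⊕_y im Q_y` the hypothesis bounds every `Y`-bipartition cut of `E` by `c` (cut identity
`rank[Π,G] = rank(ΠG(1−Π)) + rank((1−Π)GΠ)` for idempotent `Π`), the max-cut decomposition (`…CutLemma.exists_blockDiagonal_of_maxCut`, p642852) gives a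
`Q`-block-diagonal `E₁` with `rank(E − E₁) ≤ 4c`, `rank(E₁² − E₁) ≤ 3·4c`, and blockwise cheap Fitting (`…Exactification.exists_idempotent_near` on each
diagonal block; ranks add over blocks) gives the idempotent. -/
theorem stub_absoluteMergePair :
    ∀ (K : Type) [Field K] (d : ℕ) (Y : Type) [Fintype Y] [DecidableEq Y]
      (E : Matrix (Fin d) (Fin d) K) (Q : Y → Matrix (Fin d) (Fin d) K) (c : ℕ),
      E * E = E →
      (∀ y, Q y * Q y = Q y) → (∀ y y', y ≠ y' → Q y * Q y' = 0) → ∑ y, Q y = 1 →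
      (∀ B : Finset Y, (E * (∑ y ∈ B, Q y) - (∑ y ∈ B, Q y) * E).rank ≤ c) →
      ∃ E' : Matrix (Fin d) (Fin d) K, E' * E' = E' ∧ (∀ y, E' * Q y = Q y * E') ∧ (E - E').rank ≤ 16 * c :=
  Summit.PneNP.PneNP.Theorems.CnfIdealGenLengthRankDefectRepresentationsAbsoluteMergePair.stub_absoluteMergePair

/-- **LEAD `stub_coreExactification` (CoreBE; lead g18 RESHAPE 18b, OPEN — the ONE open statement the crux now hinges on).**
Block exactification ON THE CORE: the hypotheses of BE (below) plus an explicit set `S` of at most `10·r` blocks outside of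
which the compressed cells `P_x G_y` are pairwise orthogonal idempotents summing to `P_x` (this is what
`…GoodBlocks.goodBlocks` + `card_filter_mul_ne_zero_le_rank` deliver).  Conclusion as in BE: a commuting exact pair within
`μ·r` union-wise, `μ` ABSOLUTE.  Pencil (memo `Lines/cell-union-merge-g18.md` §7): W26 for `P_S` decouples the good part at cost
O(r) (there `Q' := G` is free), and the symmetric step leaves the DOUBLE CORE `|X|, |Y| = O(r)`; the open content is a merge of
`O(r)` blocks against `O(r)` cells at cost LINEAR in `r` (pinching / per-block W26 give `O(r²)`; an `Ω(r²)` example would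
refute AMB). -/
theorem stub_coreExactification :
    ∃ μ : ℕ, ∀ (K : Type) [Field K] [CharZero K] (d : ℕ) (X Y : Type) [Fintype X] [Fintype Y] [DecidableEq X]
      [DecidableEq Y] (P : X → Matrix (Fin d) (Fin d) K) (Q : Y → Matrix (Fin d) (Fin d) K) (r : ℕ)
      (U : Matrix (Fin d) (Fin r) K) (W : Matrix (Fin r) (Fin d) K) (G : Y → Matrix (Fin d) (Fin d) K)
      (α : Y → Matrix (Fin r) (Fin d) K) (β : Y → Matrix (Fin d) (Fin r) K) (S : Finset X),
      (∀ x, P x * P x = P x) → (∀ x x', x ≠ x' → P x * P x' = 0) → ∑ x, P x = 1 →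
      (∀ y, Q y * Q y = Q y) → (∀ y y', y ≠ y' → Q y * Q y' = 0) → ∑ y, Q y = 1 →
      (∀ x y, G y * P x = P x * G y) → (∀ y, Q y = G y + U * α y + β y * W) →
      S.card ≤ 10 * r →
      (∀ x ∉ S, (∀ y, P x * G y * (P x * G y) = P x * G y) ∧ (∀ y y', y ≠ y' → P x * G y * (P x * G y') = 0) ∧
        P x * (∑ y, G y) = P x) →
      ∃ (P' : X → Matrix (Fin d) (Fin d) K) (Q' : Y → Matrix (Fin d) (Fin d) K),
        (∀ x, P' x * P' x = P' x) ∧ (∀ x x', x ≠ x' → P' x * P' x' = 0) ∧ ∑ x, P' x = 1 ∧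
        (∀ y, Q' y * Q' y = Q' y) ∧ (∀ y y', y ≠ y' → Q' y * Q' y' = 0) ∧ ∑ y, Q' y = 1 ∧
        (∀ x y, P' x * Q' y = Q' y * P' x) ∧
        (∀ A : Finset X, ((∑ x ∈ A, P x) - ∑ x ∈ A, P' x).rank ≤ μ * r) ∧
        (∀ B : Finset Y, ((∑ y ∈ B, Q y) - ∑ y ∈ B, Q' y).rank ≤ μ * r) := by
  sorry

/-- **`stub_blockExactification` (BE; lead g18) — RESHAPE 18b: DERIVED from `goodBlocks` (p736001) + `stub_coreExactification`.**  ORIGINAL DOCSTRING:  BLOCK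
EXACTIFICATION: let `P` be a complete orthogonal system of idempotents and `Q` a complete orthogonal system each of whose
cells is `Q_y = G_y + U α_y + β_y W` with `G_y` in the commutant of `P` and a FIXED frame `U : d × r`, `W : r × d`
(this is exactly what the family cut lemma `…FamilyCutLemma.familyCutLemma` delivers from `c(P,Q) ≤ c`, with `r ≤ 32c`).
Then `(P, Q)` is union-wise within rank `μ·r` of a COMMUTING pair of complete orthogonal systems, `μ` ABSOLUTE.
Known (memo `Lines/cell-union-merge-g18.md` §4): true when `U, W` live in one block of `P` (pinching is then exact, cost
`≤ r`); true when every cell of `P` has rank one (random-union counting: all but `O(r)` coordinates are exactly resolved);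
all but `≤ 1100·r`-ish blocks `x` of `P` carry an EXACTLY exact compressed system `(P_x G_y P_x)_y` (Schwartz–Zippel on
the cube applied to the block-diagonal defect `G_B² − G_B`, which has rank `≤ 4·2r` for every union `B`); the open part is
the cost accounting on the `O(r)` bad blocks (spread frames).  With `familyCutLemma` its proof gives `stub_absoluteMerge`
(`absoluteMerge_of_blockExactification`), hence N0b by name and `¬RDR`. -/
theorem stub_blockExactification :
    ∃ μ : ℕ, ∀ (K : Type) [Field K] [CharZero K] (d : ℕ) (X Y : Type) [Fintype X] [Fintype Y] [DecidableEq X]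
      [DecidableEq Y] (P : X → Matrix (Fin d) (Fin d) K) (Q : Y → Matrix (Fin d) (Fin d) K) (r : ℕ)
      (U : Matrix (Fin d) (Fin r) K) (W : Matrix (Fin r) (Fin d) K) (G : Y → Matrix (Fin d) (Fin d) K)
      (α : Y → Matrix (Fin r) (Fin d) K) (β : Y → Matrix (Fin d) (Fin r) K),
      (∀ x, P x * P x = P x) → (∀ x x', x ≠ x' → P x * P x' = 0) → ∑ x, P x = 1 →
      (∀ y, Q y * Q y = Q y) → (∀ y y', y ≠ y' → Q y * Q y' = 0) → ∑ y, Q y = 1 →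
      (∀ x y, G y * P x = P x * G y) → (∀ y, Q y = G y + U * α y + β y * W) →
      ∃ (P' : X → Matrix (Fin d) (Fin d) K) (Q' : Y → Matrix (Fin d) (Fin d) K),
        (∀ x, P' x * P' x = P' x) ∧ (∀ x x', x ≠ x' → P' x * P' x' = 0) ∧ ∑ x, P' x = 1 ∧
        (∀ y, Q' y * Q' y = Q' y) ∧ (∀ y y', y ≠ y' → Q' y * Q' y' = 0) ∧ ∑ y, Q' y = 1 ∧
        (∀ x y, P' x * Q' y = Q' y * P' x) ∧
        (∀ A : Finset X, ((∑ x ∈ A, P x) - ∑ x ∈ A, P' x).rank ≤ μ * r) ∧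
        (∀ B : Finset Y, ((∑ y ∈ B, Q y) - ∑ y ∈ B, Q' y).rank ≤ μ * r) := by
  obtain ⟨μ, hμ⟩ := stub_coreExactification
  refine ⟨μ, ?_⟩
  intro K _ _ d X Y _ _ _ _ P Q r U W G α β hPi hPo hPs hQi hQo hQs hGP hQ
  -- the exceptional set: bad blocks (≤ 8r) ∪ blocks where the compressed cells do not sum to the block (≤ 2r)
  obtain ⟨S₁, hS₁, hgood⟩ :=
    Summit.PneNP.PneNP.Theorems.CnfIdealGenLengthRankDefectRepresentationsGoodBlocks.goodBlocks
      P Q G r U W α β hPi hPo hQi hQo hGP hQ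
  have hM : ∀ x, (1 - ∑ y, G y) * P x = P x * (1 - ∑ y, G y) := by
    intro x
    rw [Matrix.sub_mul, Matrix.mul_sub, Matrix.one_mul, Matrix.mul_one, Finset.sum_mul, Finset.mul_sum]
    congr 1
    exact Finset.sum_congr rfl fun y _ => hGP x y
  obtain ⟨T, hTcard, hT⟩ :=
    Summit.PneNP.PneNP.Theorems.CnfIdealGenLengthRankDefectRepresentationsGoodBlocks.card_filter_mul_ne_zero_le_rank
      P (1 - ∑ y, G y) hPi hPo hM
  have hrank : ((1 : Matrix (Fin d) (Fin d) K) - ∑ y, G y).rank ≤ 2 * r := by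
    have h1 : (1 : Matrix (Fin d) (Fin d) K) - ∑ y, G y = U * (∑ y, α y) + (∑ y, β y) * W := by
      have hQB : ∑ y, Q y = (∑ y, G y) + (U * (∑ y, α y) + (∑ y, β y) * W) := by
        rw [Matrix.mul_sum, Matrix.sum_mul, ← Finset.sum_add_distrib, ← Finset.sum_add_distrib]
        exact Finset.sum_congr rfl fun y _ => by rw [hQ y, add_assoc]
      rw [← hQs, hQB]; abel
    rw [h1]
    refine (Summit.PneNP.PneNP.Theorems.CnfIdealGenLengthRankDefectRepresentationsMergeLowerBound.rank_add_le' _ _).trans ?_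
    have ha := Summit.PneNP.PneNP.Theorems.CnfIdealGenLengthRankDefectRepresentationsFamilyCutLemma.rank_mul_le_inner
      U (∑ y, α y)
    have hb := Summit.PneNP.PneNP.Theorems.CnfIdealGenLengthRankDefectRepresentationsFamilyCutLemma.rank_mul_le_inner
      (∑ y, β y) W
    omega
  refine hμ K d X Y P Q r U W G α β (S₁ ∪ T) hPi hPo hPs hQi hQo hQs hGP hQ ?_ ?_
  · calc (S₁ ∪ T).card ≤ S₁.card + T.card := Finset.card_union_le _ _
      _ ≤ 8 * r + 2 * r := Nat.add_le_add hS₁ (hTcard.trans hrank)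
      _ = 10 * r := by ring
  · intro x hx
    have hx₁ : x ∉ S₁ := fun h => hx (Finset.mem_union_left _ h)
    have hxT : x ∉ T := fun h => hx (Finset.mem_union_right _ h)
    refine ⟨(hgood x hx₁).1, (hgood x hx₁).2, ?_⟩
    have h0 := hT x hxT
    rw [Matrix.mul_sub, Matrix.mul_one, sub_eq_zero] at h0
    exact h0.symm

/-- **AMB from BE and the family cut lemma** (`λ = 32 μ`). -/
theorem absoluteMerge_of_blockExactification (μ : ℕ)
    (hBE : ∀ (K : Type) [Field K] [CharZero K] (d : ℕ) (X Y : Type) [Fintype X] [Fintype Y] [DecidableEq X]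
      [DecidableEq Y] (P : X → Matrix (Fin d) (Fin d) K) (Q : Y → Matrix (Fin d) (Fin d) K) (r : ℕ)
      (U : Matrix (Fin d) (Fin r) K) (W : Matrix (Fin r) (Fin d) K) (G : Y → Matrix (Fin d) (Fin d) K)
      (α : Y → Matrix (Fin r) (Fin d) K) (β : Y → Matrix (Fin d) (Fin r) K),
      (∀ x, P x * P x = P x) → (∀ x x', x ≠ x' → P x * P x' = 0) → ∑ x, P x = 1 →
      (∀ y, Q y * Q y = Q y) → (∀ y y', y ≠ y' → Q y * Q y' = 0) → ∑ y, Q y = 1 →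
      (∀ x y, G y * P x = P x * G y) → (∀ y, Q y = G y + U * α y + β y * W) →
      ∃ (P' : X → Matrix (Fin d) (Fin d) K) (Q' : Y → Matrix (Fin d) (Fin d) K),
        (∀ x, P' x * P' x = P' x) ∧ (∀ x x', x ≠ x' → P' x * P' x' = 0) ∧ ∑ x, P' x = 1 ∧
        (∀ y, Q' y * Q' y = Q' y) ∧ (∀ y y', y ≠ y' → Q' y * Q' y' = 0) ∧ ∑ y, Q' y = 1 ∧
        (∀ x y, P' x * Q' y = Q' y * P' x) ∧
        (∀ A : Finset X, ((∑ x ∈ A, P x) - ∑ x ∈ A, P' x).rank ≤ μ * r) ∧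
        (∀ B : Finset Y, ((∑ y ∈ B, Q y) - ∑ y ∈ B, Q' y).rank ≤ μ * r)) :
    AbsoluteMerge (32 * μ) := by
  intro K _ _ d X Y _ _ P Q c hPi hPo hPs hQi hQo hQs hc
  classical
  obtain ⟨r, U, W, hr, key⟩ :=
    Summit.PneNP.PneNP.Theorems.CnfIdealGenLengthRankDefectRepresentationsFamilyCutLemma.familyCutLemma
      P Q c hPi hPo hPs hQi hQo hQs hc
  choose G α β hG hQ using key
  obtain ⟨P', Q', h1, h2, h3, h4, h5, h6, h7, h8, h9⟩ :=
    hBE K d X Y P Q r U W G α β hPi hPo hPs hQi hQo hQs (fun x y => hG y x) hQ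
  refine ⟨P', Q', h1, h2, h3, h4, h5, h6, h7, fun A => (h8 A).trans ?_, fun B => (h9 B).trans ?_⟩
  · calc μ * r ≤ μ * (32 * c) := Nat.mul_le_mul_left μ hr
      _ = 32 * μ * c := by ring
  · calc μ * r ≤ μ * (32 * c) := Nat.mul_le_mul_left μ hr
      _ = 32 * μ * c := by ring

/-- **`stub_absoluteMerge`: ∃ λ, AMB(λ)** — RESHAPE g18: no longer a sorry; DERIVED from the family cut lemma (landed, p734569) and the one open lead stub `stub_blockExactification` (`λ = 32 μ`).  (Registered signature unchanged.)  ORIGINAL DOCSTRING (g17):  Theorem in its shadow: `|X| = 2` (one idempotent vs an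
exact system of any size: cut lemma `exists_blockDiagonal_of_maxCut` with `|Y|` colours + blockwise `exists_idempotent_near`, `λ ≤ 16`,
`Q' = Q`).  Constants polynomial in `min(|X|,|Y|)` are easy (generator-by-generator insertion + JCL) and useless (`2^(2^k)` cells at level `k`
of the recursion); direct sums do not refute absoluteness (the max over unions adds up over summands exactly as the merge cost does).  With T1–T3 its proof closes N0b and REFUTES the crux (`not_RankDefectRepresentations_of_absoluteMerge`);
its refutation — two exact Boolean algebras of idempotents with merge cost `≫ max_{A,B} rank[P_A,Q_B]` — kills every divide-and-conquer
route to N0b. -/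
theorem stub_absoluteMerge :
    ∃ lam : ℕ,
    ∀ (K : Type) [Field K] [CharZero K] (d : ℕ) (X Y : Type) [Fintype X] [Fintype Y]
      (P : X → Matrix (Fin d) (Fin d) K) (Q : Y → Matrix (Fin d) (Fin d) K) (c : ℕ),
      (∀ x, P x * P x = P x) → (∀ x x', x ≠ x' → P x * P x' = 0) → ∑ x, P x = 1 →
      (∀ y, Q y * Q y = Q y) → (∀ y y', y ≠ y' → Q y * Q y' = 0) → ∑ y, Q y = 1 →
      (∀ (A : Finset X) (B : Finset Y),
        ((∑ x ∈ A, P x) * (∑ y ∈ B, Q y) - (∑ y ∈ B, Q y) * (∑ x ∈ A, P x)).rank ≤ c) →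
      ∃ (P' : X → Matrix (Fin d) (Fin d) K) (Q' : Y → Matrix (Fin d) (Fin d) K),
        (∀ x, P' x * P' x = P' x) ∧ (∀ x x', x ≠ x' → P' x * P' x' = 0) ∧ ∑ x, P' x = 1 ∧
        (∀ y, Q' y * Q' y = Q' y) ∧ (∀ y y', y ≠ y' → Q' y * Q' y' = 0) ∧ ∑ y, Q' y = 1 ∧
        (∀ x y, P' x * Q' y = Q' y * P' x) ∧
        (∀ A : Finset X, ((∑ x ∈ A, P x) - ∑ x ∈ A, P' x).rank ≤ lam * c) ∧
        (∀ B : Finset Y, ((∑ y ∈ B, Q y) - ∑ y ∈ B, Q' y).rank ≤ lam * c) := by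
  obtain ⟨μ, hμ⟩ := stub_blockExactification
  exact ⟨32 * μ, absoluteMerge_of_blockExactification μ hμ⟩

/-! ## Bridges: each stub is definitionally a proof of its named statement -/

theorem tableOfGenerator_of_stub : PolyStableIdem → UniformStability := stub_tableOfGenerator

theorem jointCutLemma_of_stub : ∃ κ : ℕ, JointCutLemma κ := stub_jointCutLemma

theorem polyOfAbsoluteMerge_of_stub : PolyOfAbsoluteMerge := stub_polyOfAbsoluteMerge

theorem absoluteMerge_of_stub : ∃ lam : ℕ, AbsoluteMerge lam := stub_absoluteMerge

/-! ## Compositions (sorry-free) -/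

/-- THE SKELETON THEOREM: the crux BY NAME from the carried positive stub `stub_tautologyInstability` (kernel-checked equivalence
p597485), exactly as in `rank_dehn_ladder.lean`.  (The negative closure of this line is `not_RankDefectRepresentations_of_stubs`.) -/
theorem RankDefectRepresentations_holds_of_stubs :
    Summit.PneNP.PneNP.Theses.CnfIdealGenLength.RankDefectRepresentations :=
  Summit.PneNP.PneNP.Theorems.CnfIdealGenLengthRankDefectRepresentationsIffTautologyInstability.rankDefectRepresentations_iff_tautologyInstability.mpr
    stub_tautologyInstability

/-- **N0b REFUTES the crux** (p607059 + p542939). -/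
theorem not_RankDefectRepresentations_of_uniformStability (h : UniformStability) :
    ¬ Summit.PneNP.PneNP.Theses.CnfIdealGenLength.RankDefectRepresentations :=
  Summit.PneNP.PneNP.Theorems.CnfIdealGenLengthRankDefectRepresentationsUniformStability.not_rankDefectRepresentations_of_uniformStability
    h

/-- **AMB ⇒ generator-form N0b**, through the TRUE stubs T2 (JCL) and T3 (bookkeeping). -/
theorem polyStableIdem_of_absoluteMerge (lam : ℕ) (h : AbsoluteMerge lam) : PolyStableIdem := by
  obtain ⟨κ, hκ⟩ := jointCutLemma_of_stub
  exact polyOfAbsoluteMerge_of_stub lam κ h hκ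

/-- **AMB ⇒ N0b (table form)**, through T1. -/
theorem uniformStability_of_absoluteMerge (lam : ℕ) (h : AbsoluteMerge lam) : UniformStability :=
  tableOfGenerator_of_stub (polyStableIdem_of_absoluteMerge lam h)

/-- **AMB REFUTES the crux.** -/
theorem not_RankDefectRepresentations_of_absoluteMerge (lam : ℕ) (h : AbsoluteMerge lam) :
    ¬ Summit.PneNP.PneNP.Theses.CnfIdealGenLength.RankDefectRepresentations :=
  not_RankDefectRepresentations_of_uniformStability (uniformStability_of_absoluteMerge lam h)

/-- Generator-form N0b from the registered stubs of this line. -/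
theorem polyStableIdem_of_stubs : PolyStableIdem := by
  obtain ⟨lam, h⟩ := absoluteMerge_of_stub
  exact polyStableIdem_of_absoluteMerge lam h

/-- **The registered N0b statement `stub_uniformStability` BY NAME (its exact statement), from this line's own stubs**
(`stub_absoluteMerge`, `stub_jointCutLemma`, `stub_polyOfAbsoluteMerge`, `stub_tableOfGenerator`). -/
theorem uniformStability_of_stubs :
    ∃ a : ℕ, ∀ᶠ n : ℕ in atTop, ∀ (K : Type) [Field K] [CharZero K] (d δ : ℕ)
      (ρ : Finset (Fin n) → Matrix (Fin d) (Fin d) K), ρ ∅ = 1 →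
      (∀ S T : Finset (Fin n), (ρ S * ρ T - ρ (symmDiff S T)).rank ≤ δ) →
      ∃ π : Finset (Fin n) → Matrix (Fin d) (Fin d) K, π ∅ = 1 ∧
        (∀ S T : Finset (Fin n), π S * π T = π (symmDiff S T)) ∧
        ∀ S : Finset (Fin n), (ρ S - π S).rank ≤ n ^ a * δ :=
  tableOfGenerator_of_stub polyStableIdem_of_stubs

/-- The crux REFUTED modulo the registered stubs of this line (audit display of the negative closure). -/
theorem not_RankDefectRepresentations_of_stubs :
    ¬ Summit.PneNP.PneNP.Theses.CnfIdealGenLength.RankDefectRepresentations :=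
  not_RankDefectRepresentations_of_uniformStability uniformStability_of_stubs

/-! ## Two elementary facts the workers start from (proved here as sanity of the typing) -/

/-- "Commutator with an idempotent = the two off-diagonal corners": the algebraic identity behind step (0) of T2. -/
theorem comm_idempotent_eq {K : Type} [Field K] {d : ℕ} (R G : Matrix (Fin d) (Fin d) K) :
    R * G - G * R = R * G * (1 - R) - (1 - R) * G * R := by
  simp only [Matrix.mul_sub, Matrix.sub_mul, Matrix.mul_one, Matrix.one_mul, Matrix.mul_assoc]
  abel

/-- The level-0 data of the recursion in T3: the unions of the two-cell system `{E, 1 − E}` are `0, E, 1 − E, 1`, so the cross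
currency of two single idempotents is their commutator rank (here: the four commutators are `±[E,F]` or `0`). -/
theorem comm_compl_left {K : Type} [Field K] {d : ℕ} (E F : Matrix (Fin d) (Fin d) K) :
    (1 - E) * F - F * (1 - E) = -(E * F - F * E) := by
  rw [Matrix.sub_mul, Matrix.mul_sub, Matrix.one_mul, Matrix.mul_one]
  abel

end Summit.PneNP.PneNP.Cruxes.RankDefectRepresentations.CellUnionMerge
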